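import Mathlib
import Summits.ValiantsHypothesis.ValiantsHypothesis.Theorems.BarrierLeverPartitionMinorsHitByVPHiddenStatesTwoSkeleton
import Summits.ValiantsHypothesis.ValiantsHypothesis.Theorems.BarrierLeverPartitionMinorsHitByVPHiddenStatesFiveRank

/-!
# Route BarrierLever — item `PartitionMinorsHitByVP` (stmt-ValiantsHypothesis-19717), line `hidden-states`:
# the registered stub `stub_qstarCube` (Conjecture Q\*(h³), the single-cube door of record) is FALSE

Helper file (`--supports stmt-ValiantsHypothesis-19717`; cell valiant-natproofs, rung V4, 𝒟-side door (c), registered line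
`Cruxes/PartitionMinorsHitByVP/Lines/hidden_states.lean`; prover seat val-np-p4 gen 15). One bookkeeping `def` (`fiveU`, an
enumeration of 5-subsets). Closes NO item: it REFUTES one of the line's two named sufficient forms, by name and verbatim.

RESULT (`not_stub_qstarCube`, the body of `Stmt.stub_qstarCube` of the line file, negated):

  `¬ ∃ h₁ Kf, (∀ h ≥ h₁, h ≤ Kf h ∧ Kf h ≤ h·h·h) ∧ ∀ h ≥ h₁, ∀ r (u : Fin r → Finset (Fin h)), Injective u → BallGood h (Kf h) r u`.

In fact (`exists_not_ballGood`): for EVERY `h ≥ 10¹⁰` and EVERY state count `K` with `h ≤ K ≤ h⁴` some injective family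
`u` is not `BallGood h K`; so no single-cube hidden-state design with polynomially many (`≤ h⁴`) states meets the hypothesis
of any of the landed doors `partitionMinorsHitByVP_of_ballGood` (`K = h`; cf. the tree's `not_ballGood_hypothesis`),
`…_of_ballGood'` (`K ≤ h²`; cf. `TripleRank.not_ballGood_sq_hypothesis`), `…_of_ballGood_cube` (`K ≤ h³`, = `stub_qstarCube`)
or a widened `K ≤ h⁴` door (`not_ballGood_pow_four_hypothesis`). val-np-p3 g9's kernel negatives (`…TwoSkeleton`, `…TwoSkeletonWindow`: the family of
all triples of `Fin h`) cover `K ∈ [h², h³/32]` and leave `(≈h³/6, h³]` open because `C(h,3) < h³`; this file closes the gap.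

WITNESS AND MECHANISM (odd-uniform, vertex-sparse two-layer starvation). Given `K ∈ [h, h⁴]` put
`n := min h (⌊√((K−1)/6)⌋ − 1)`, `K' := 6(n+1)² + 1 ≤ K`, `r := K + 1 + 18(n+1)⁴ ≤ 1 + K + C(K',2)`, and let `u = fiveU` be
`r` DISTINCT 5-SUBSETS of the first `n` coordinates (`r ≤ C(n,5)` because `n ≥ 40300`: `rows_available`). The ball–colex
family of size `r` on `K` states is then two-layer with its `r − 1 − K` pairs inside the first `K'` states
(`TripleRank.card_le_two_of_threshold`, `TripleRank.pair_subset_lowStates_of_threshold`), and the FIVE-ROW RANK BOUND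
`FiveRank.det_eq_zero_of_rows_le_five` applies: the `r` rows span at most `(K+1) + 2K'(n+1)² < r` dimensions, so the additive
matrix is singular for EVERY table (`not_ballGood_fiveU`). The vertex budget `n < h` is what makes small `K` (down to `K = h`)
reachable; rows of size five (rather than three) are what makes `K` up to `h⁴` reachable.

WHAT THIS IS NOT: the line `hidden-states` is NOT dead — its composition `PartitionMinorsHitByVP_of` goes through
`stub_universalJoinWide`, and JOINS (`stub_qjoinSharp`: ≤ 2h pieces of h² states; `stub_universalJoinWide`) are untouched by
this count (m pieces multiply the pair budget by m); item 19717 stays OPEN; nothing on crux 14610 or VP ≠ VNP.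
-/

set_option linter.dupNamespace false

namespace Summit.ValiantsHypothesis.ValiantsHypothesis.Theorems.BarrierLever.HiddenStates

open Finset Matrix

noncomputable section

namespace FiveRank

open TripleRank (lowStates card_lowStates card_le_two_of_threshold pair_subset_lowStates_of_threshold
  two_mul_choose_two)

variable {h n : ℕ}

/-! ## The five-uniform witness family on the first `n` coordinates -/

/-- The first `n` coordinates of `Fin h`. -/
abbrev lowVerts (h n : ℕ) (hn : n ≤ h) : Finset (Fin h) :=
  (Finset.univ : Finset (Fin n)).map (Fin.castLEEmb hn)

/-- The first `n` coordinates number `n`. -/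
theorem card_lowVerts (hn : n ≤ h) : (lowVerts h n hn).card = n := by
  simp [lowVerts]

/-- There are `C(n,5)` five-subsets of the first `n` coordinates. -/
theorem card_powersetCard_five_lowVerts (hn : n ≤ h) : ((lowVerts h n hn).powersetCard 5).card = n.choose 5 := by
  rw [Finset.card_powersetCard, card_lowVerts]

/-- `r ≤ C(n,5)` distinct 5-subsets of the first `n` coordinates of `Fin h`, enumerated by `Fin r`. -/
def fiveU (h n : ℕ) (hn : n ≤ h) (r : ℕ) (hr : r ≤ n.choose 5) : Fin r → Finset (Fin h) :=
  fun i => ((((lowVerts h n hn).powersetCard 5).equivFin.symm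
    (Fin.castLE (by rw [card_powersetCard_five_lowVerts]; exact hr) i)) : Finset (Fin h))

/-- The enumeration is injective. -/
theorem fiveU_injective (hn : n ≤ h) (r : ℕ) (hr : r ≤ n.choose 5) : Function.Injective (fiveU h n hn r hr) := by
  intro i j hij
  unfold fiveU at hij
  have := ((lowVerts h n hn).powersetCard 5).equivFin.symm.injective (Subtype.ext hij)
  exact Fin.castLE_injective _ this

/-- Every enumerated set is a 5-subset of the first `n` coordinates. -/
theorem fiveU_mem (hn : n ≤ h) (r : ℕ) (hr : r ≤ n.choose 5) (i : Fin r) :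
    fiveU h n hn r hr i ∈ (lowVerts h n hn).powersetCard 5 := by
  unfold fiveU
  exact (((lowVerts h n hn).powersetCard 5).equivFin.symm _).2

/-- Every enumerated set has five elements. -/
theorem card_fiveU (hn : n ≤ h) (r : ℕ) (hr : r ≤ n.choose 5) (i : Fin r) : (fiveU h n hn r hr i).card = 5 :=
  (Finset.mem_powersetCard.mp (fiveU_mem hn r hr i)).2

/-- Every enumerated set lies inside the first `n` coordinates. -/
theorem fiveU_subset (hn : n ≤ h) (r : ℕ) (hr : r ≤ n.choose 5) (i : Fin r) :
    fiveU h n hn r hr i ⊆ lowVerts h n hn :=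
  (Finset.mem_powersetCard.mp (fiveU_mem hn r hr i)).1

/-! ## The parametric negative -/

/-- **The five-uniform family defeats the single cube (general count form).** For `K' ≤ K`, `r ≤ C(n,5)` distinct
5-subsets of the first `n ≤ h` coordinates, `r ≤ 1 + K + C(K',2)` (two-layer ball–colex family with pairs on the first `K'`
states) and `(K+1) + 2K'(n+1)² < r`, the family `fiveU` is NOT `BallGood h K r`. -/
theorem not_ballGood_fiveU (h n K K' r : ℕ) (hn : n ≤ h) (hr : r ≤ n.choose 5) (hK' : K' ≤ K)
    (hr1 : r ≤ 1 + K + K'.choose 2) (hcount : (K + 1) + 2 * (K' * (n + 1) ^ 2) < r) :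
    ¬ BallGood h K r (fiveU h n hn r hr) := by
  classical
  intro hgood
  have hr0 : r ≤ 1 + K + K.choose 2 := hr1.trans (by have := Nat.choose_le_choose 2 hK'; omega)
  have hrK : r ≤ 2 ^ K := by
    -- `1 + K + C(K,2) ≤ 2^K`: the sets of size `≤ 2` among all subsets of `Fin K`
    refine hr0.trans ?_
    have hsum : ∑ i ∈ Finset.range 3, K.choose i ≤ ∑ i ∈ Finset.range (K + 1), K.choose i := by
      rcases Nat.lt_or_ge K 2 with hK2 | hK2
      · interval_cases K <;> simp [Finset.sum_range_succ]
      · exact Finset.sum_le_sum_of_subset (Finset.range_subset_range.mpr (by omega))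
    rw [Nat.sum_range_choose] at hsum
    simpa [Finset.sum_range_succ, Nat.choose_zero_right, Nat.choose_one_right, add_assoc] using hsum
  obtain ⟨e, he, hthr⟩ := exists_ballColex K r hrK
  obtain ⟨tx, htx⟩ := hgood e he hthr
  apply htx
  have he2 : ∀ k, (e k).card ≤ 2 := fun k => card_le_two_of_threshold hr0 e hthr k
  have heS : ∀ k, (e k).card = 2 → e k ⊆ lowStates K K' hK' := fun k hk =>
    pair_subset_lowStates_of_threshold hK' hr1 e hthr k hk
  refine det_eq_zero_of_rows_le_five (fiveU h n hn r hr) e (lowStates K K' hK') (lowVerts h n hn) he2 heS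
    (fun i => (card_fiveU hn r hr i).le) (fun i => fiveU_subset hn r hr i) ?_ tx
  rw [card_lowStates, Fintype.card_fin]
  have hsm := card_smallSub_le (lowVerts h n hn)
  rw [card_lowVerts] at hsm
  calc (K + 1) + 2 * (K' * (smallSub (lowVerts h n hn)).card) ≤ (K + 1) + 2 * (K' * (n + 1) ^ 2) := by gcongr
    _ < r := hcount

/-! ## The arithmetic of the witness: `K' = 6(n+1)² + 1`, `r = K + 1 + 18(n+1)⁴` -/

/-- The rank count: `(K+1) + 2K'(n+1)² < r`. -/
theorem count_lt (K n : ℕ) : (K + 1) + 2 * ((6 * (n + 1) ^ 2 + 1) * (n + 1) ^ 2) < K + 1 + 18 * (n + 1) ^ 4 := by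
  have h1 : 1 ≤ (n + 1) ^ 2 := Nat.one_le_pow _ _ (by omega)
  have h4 : (n + 1) ^ 4 = (n + 1) ^ 2 * (n + 1) ^ 2 := by ring
  rw [h4]
  nlinarith

/-- The two-layer condition: `r ≤ 1 + K + C(K',2)`. -/
theorem two_layer_le (K n : ℕ) : K + 1 + 18 * (n + 1) ^ 4 ≤ 1 + K + (6 * (n + 1) ^ 2 + 1).choose 2 := by
  have h2 := two_mul_choose_two (6 * (n + 1) ^ 2)
  have h4 : (n + 1) ^ 4 = (n + 1) ^ 2 * (n + 1) ^ 2 := by ring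
  rw [h4]
  nlinarith

/-- `(n − 4)⁵ ≤ 120·C(n,5)`. -/
theorem pow_five_le_choose_five (n : ℕ) : (n - 4) ^ 5 ≤ 120 * n.choose 5 := by
  have h1 : (n + 1 - 5) ^ 5 ≤ n.descFactorial 5 := Nat.pow_sub_le_descFactorial n 5
  have h2 : n.descFactorial 5 = (5 : ℕ).factorial * n.choose 5 := Nat.descFactorial_eq_factorial_mul_choose n 5
  have h3 : (5 : ℕ).factorial = 120 := by decide
  have h4 : n + 1 - 5 = n - 4 := by omega
  rw [h4, h2, h3] at h1
  exact h1

/-- **Enough 5-subsets on `n ≥ 40300` coordinates**: `n⁴ + 6(n+2)² + 7 + 18(n+1)⁴ ≤ C(n,5)` (crude: the left side is at most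
`335 (n−4)⁴` and `120 · 335 = 40200 ≤ n − 4`). -/
theorem rows_available (n : ℕ) (hn : 40300 ≤ n) : n ^ 4 + 6 * (n + 2) ^ 2 + 7 + 18 * (n + 1) ^ 4 ≤ n.choose 5 := by
  obtain ⟨m, rfl⟩ : ∃ m, n = m + 4 := ⟨n - 4, by omega⟩
  have hm : 40296 ≤ m := by omega
  have hc : m ^ 5 ≤ 120 * (m + 4).choose 5 := by
    have := pow_five_le_choose_five (m + 4)
    simpa using this
  have hm1 : 1 ≤ m ^ 4 := Nat.one_le_pow _ _ (by omega)
  have e1 : (m + 4) ^ 4 ≤ 16 * m ^ 4 := by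
    have h1 : (m + 4) ^ 4 ≤ (2 * m) ^ 4 := Nat.pow_le_pow_left (by omega) 4
    nlinarith
  have e2 : 6 * (m + 4 + 2) ^ 2 ≤ 24 * m ^ 4 := by
    have h1 : (m + 4 + 2) ^ 2 ≤ (2 * m) ^ 2 := Nat.pow_le_pow_left (by omega) 2
    have h2 : m ^ 2 ≤ m ^ 4 := Nat.pow_le_pow_right (by omega) (by norm_num)
    nlinarith
  have e4 : 18 * (m + 4 + 1) ^ 4 ≤ 288 * m ^ 4 := by
    have h1 : (m + 4 + 1) ^ 4 ≤ (2 * m) ^ 4 := Nat.pow_le_pow_left (by omega) 4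
    nlinarith
  have e5 : 120 * ((m + 4) ^ 4 + 6 * (m + 4 + 2) ^ 2 + 7 + 18 * (m + 4 + 1) ^ 4) ≤ 120 * (335 * m ^ 4) := by
    apply Nat.mul_le_mul_left
    omega
  have e6 : 120 * (335 * m ^ 4) ≤ m ^ 5 := by
    have : 40200 * m ^ 4 ≤ m * m ^ 4 := Nat.mul_le_mul_right _ (by omega)
    calc 120 * (335 * m ^ 4) = 40200 * m ^ 4 := by ring
      _ ≤ m * m ^ 4 := this
      _ = m ^ 5 := by ring
  exact Nat.le_of_mul_le_mul_left (e5.trans (e6.trans hc)) (by norm_num)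

/-- **For every `h ≥ 10¹⁰` and EVERY state count `K ∈ [h, h⁴]`, some injective (5-uniform) family of subsets of `Fin h`
is not `BallGood h K`.** -/
theorem exists_not_ballGood (h K : ℕ) (hh : 10 ^ 10 ≤ h) (hKlo : h ≤ K) (hKhi : K ≤ h ^ 4) :
    ∃ (r : ℕ) (u : Fin r → Finset (Fin h)), Function.Injective u ∧ ¬ BallGood h K r u := by
  classical
  -- the vertex budget
  set m := (K - 1) / 6 with hm
  set s := Nat.sqrt m with hs
  set n := min h (s - 1) with hn
  have hnh : n ≤ h := min_le_left _ _
  have hm1 : 1 ≤ m := by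
    rw [hm]
    exact (Nat.le_div_iff_mul_le (by norm_num)).mpr (by omega)
  have hs1 : 1 ≤ s := Nat.succ_le_of_lt (Nat.sqrt_pos.mpr (by omega))
  have hn1 : n + 1 ≤ s := by
    have : n ≤ s - 1 := min_le_right _ _
    omega
  -- the core states fit: K' = 6(n+1)² + 1 ≤ K
  have hK'K : 6 * (n + 1) ^ 2 + 1 ≤ K := by
    have h1 : (n + 1) ^ 2 ≤ s ^ 2 := Nat.pow_le_pow_left hn1 2
    have h2 : s ^ 2 ≤ m := Nat.sqrt_le' m
    have h3 : 6 * m ≤ K - 1 := by rw [hm]; exact Nat.mul_div_le (K - 1) 6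
    omega
  -- either n = h (and K ≤ h⁴ = n⁴) or n = s − 1 (and K ≤ 6(n+2)²); in both cases n is large
  have hlt_s : m < (s + 1) ^ 2 := by
    have := Nat.lt_succ_sqrt' m
    rwa [Nat.succ_eq_add_one] at this
  have hcases : (n = h ∧ K ≤ n ^ 4) ∨ (40300 ≤ n ∧ K ≤ 6 * (n + 2) ^ 2) := by
    rcases Nat.lt_or_ge (s - 1) h with hlt | hge
    · right
      have hns : n = s - 1 := by rw [hn]; exact min_eq_right hlt.le
      have hs2 : s + 1 = n + 2 := by omega
      rw [hs2] at hlt_s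
      have hKm : K - 1 < (n + 2) ^ 2 * 6 := (Nat.div_lt_iff_lt_mul (by norm_num)).mp hlt_s
      refine ⟨?_, by omega⟩
      -- m ≥ (10¹⁰ − 1)/6 forces n + 2 > 40301
      by_contra hsmall
      push Not at hsmall
      have h1 : (n + 2) ^ 2 ≤ 40301 ^ 2 := Nat.pow_le_pow_left (by omega) 2
      have h2 : (10 ^ 10 - 1) / 6 ≤ m := by rw [hm]; exact Nat.div_le_div_right (by omega)
      norm_num at h2
      omega
    · left
      have hnh' : n = h := by rw [hn]; exact min_eq_left hge
      exact ⟨hnh', by rw [hnh']; exact hKhi⟩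
  have hnbig : 40300 ≤ n := by
    rcases hcases with ⟨hnh', -⟩ | ⟨hbig, -⟩
    · omega
    · exact hbig
  -- the rows
  have hrows := rows_available n hnbig
  have hrC : K + 1 + 18 * (n + 1) ^ 4 ≤ n.choose 5 := by
    rcases hcases with ⟨-, hK4⟩ | ⟨-, hK2⟩
    · omega
    · omega
  refine ⟨K + 1 + 18 * (n + 1) ^ 4, fiveU h n hnh _ hrC, fiveU_injective hnh _ hrC, ?_⟩
  exact not_ballGood_fiveU h n K (6 * (n + 1) ^ 2 + 1) _ hnh hrC hK'K (two_layer_le K n) (count_lt K n)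

/-! ## The refutations -/

/-- **No single-cube hidden-state design with `h ≤ Kf h ≤ h⁴` meets the door hypothesis, from any `h₁` on.** -/
theorem not_ballGood_pow_four_hypothesis (h₁ : ℕ) (Kf : ℕ → ℕ)
    (hK : ∀ h : ℕ, h₁ ≤ h → h ≤ Kf h ∧ Kf h ≤ h ^ 4) :
    ¬ ∀ h : ℕ, h₁ ≤ h → ∀ (r : ℕ) (u : Fin r → Finset (Fin h)), Function.Injective u → BallGood h (Kf h) r u := by
  intro H
  set h := max h₁ (10 ^ 10) with hh
  have hh₁ : h₁ ≤ h := le_max_left _ _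
  have hh0 : 10 ^ 10 ≤ h := le_max_right _ _
  obtain ⟨hlo, hhi⟩ := hK h hh₁
  obtain ⟨r, u, hu, hbad⟩ := exists_not_ballGood h (Kf h) hh0 hlo hhi
  exact hbad (H h hh₁ r u hu)

/-- **THE REGISTERED STUB `stub_qstarCube` OF THE LINE `hidden-states` IS FALSE** (its statement `Stmt.stub_qstarCube`,
verbatim, negated): there are no `h₁` and `Kf` with `h ≤ Kf h ≤ h·h·h` (`h ≥ h₁`) such that every injective family of subsets
of `Fin h`, `h ≥ h₁`, is `BallGood h (Kf h) r`. Equivalently the hypothesis of the door of record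
`partitionMinorsHitByVP_of_ballGood_cube` is unsatisfiable. -/
theorem not_stub_qstarCube :
    ¬ ∃ (h₁ : ℕ) (Kf : ℕ → ℕ), (∀ h : ℕ, h₁ ≤ h → h ≤ Kf h ∧ Kf h ≤ h * h * h) ∧
      ∀ h : ℕ, h₁ ≤ h → ∀ (r : ℕ) (u : Fin r → Finset (Fin h)), Function.Injective u → BallGood h (Kf h) r u := by
  rintro ⟨h₁, Kf, hK, H⟩
  refine not_ballGood_pow_four_hypothesis (max h₁ 1) Kf (fun h hh => ?_) (fun h hh => H h ((le_max_left _ _).trans hh))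
  obtain ⟨hlo, hhi⟩ := hK h ((le_max_left _ _).trans hh)
  have h1 : 1 ≤ h := (le_max_right _ _).trans hh
  refine ⟨hlo, hhi.trans ?_⟩
  calc h * h * h = h ^ 3 := by ring
    _ ≤ h ^ 4 := Nat.pow_le_pow_right h1 (by norm_num)

end FiveRank

end

end Summit.ValiantsHypothesis.ValiantsHypothesis.Theorems.BarrierLever.HiddenStates
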